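import Summits.ValiantsHypothesis.ValiantsHypothesis.Theorems.LacunarySymmetroidMatrixDescartesCensusSqTwistRuns
import Summits.ValiantsHypothesis.ValiantsHypothesis.Theorems.LacunarySymmetroidMatrixDescartesCensusFlankRow

/-!
# `MatrixDescartes` census — W4: the edge `0..9` (pure channel-9 family, THEOREM O9) — the square-root-free split

HONEST FRAMING.  Object-search cell `pub-symmetroid`, item `DoorA26 = PosRootLawAt 2 6 19` (stmt-ValiantsHypothesis-19979,
OPEN, typed, never asserted).  W4 line (engine-1 g17–g22: notes TROPFAN-W4-E1G17, CAPACITY09-E1G18, TWOROW-E1G19,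
W4-E1G20/21): degenerations of HYPOTHETICAL Descartes-sharp symmetric `2 × 2` six-term pencils.  On chamber 1706
(pair-sum order of `(0,2,3,7,16,27)`) the eight faces `{9} ∪ S`, `S ⊆ {17,18,19}` of the cone `C₇` have the low hull
edge `0..9`: the ten Gram entries `q₀₀, b₀₁, b₀₂, q₁₁, b₁₂, q₂₂, b₀₃, b₁₃, b₂₃, q₃₃` at the exponents
`0, d₁, d₂, 2d₁, d₁+d₂, 2d₂, d₃, d₁+d₃, d₂+d₃, 2d₃`, with the `{1,2,3}` block of RANK ONE, i.e. the edge form is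
`F = q₀ + b₁X^{d₁} + b₂X^{d₂} + b₃X^{d₃} − (y₁X^{d₁} + y₂X^{d₂} + y₃X^{d₃})²` (`y₁y₂ < 0 < y₁y₃`); hull-edge
sharpness would need `9 = #terms − 1` positive roots COUNTED WITH MULTIPLICITY (seat THEOREM O9, CAPACITY09-E1G18 §8:
capacity `≤ 7`, by a conic/convexity argument).  This file gives the KERNEL route, square-root-free:
* `countP_posRoots_edge09_le_residual` — four Euler twists (the tree's `countP_posRoots_le_countP_twists`) kill the
  free letters `q₀, b₁, b₂, b₃` at the cost of `4` roots and leave the 6-nomial `G = Σ A_{ij} y_i y_j X^{d_i+d_j}`,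
  `A_{ij} = m(d_i+d_j)`, `m(a) = a(a−d₁)(a−d₂)(a−d₃)` (a ternary quadratic form on the moment curve);
* `countP_posRoots_quadform_le` — the SPLIT: if `A = P − uuᵀ` with `P ⪰ 0` given by rational `LDLᵀ` data
  (`P = a(·)² + c(·)² + f(·)²`, `f > 0`) then `G = R − p²` with `R = Σ P_{ij}y_iy_jX^{d_i+d_j} > 0` on `(0,∞)` and
  `p = Σ u_iy_iX^{d_i}`, so the tree's RUNS LEMMA `countP_posRoots_sub_sq_le` applies; `X·(pR′ − 2Rp′)` is an explicit
  7-nomial (`X_mul_sqTwist_quadform`; the cubic terms in `u` cancel) and seven sign conditions on its coefficients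
  (two blocks) give `#Z₊^{mult}(G) ≤ #Z₊^{mult}(p) + 2 ≤ 4`, hence `#Z₊^{mult}(F) ≤ 8 < 9`;
The per-triple certificates `u` (ten triples `(d₁,d₂,d₃) − d₀` of the 230 core supports) are in the companion file
`…CensusEdgeZeroNineCore` (with the coarse form `… ≤ 4` and one more real-weight Euler twist).  Nothing here bounds `ζ_sym(2,6)`, decides `DoorA26`, or bears on the crux `MatrixDescartes`
(stmt-ValiantsHypothesis-18050) / `VP ≠ VNP`: a dead channel is a statement about hypothetical objects.

[folklore] Rolle with multiplicity (Euler twists; `F/p²` between roots) + Descartes' bound by sign blocks; no single source.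
-/

-- `Summit.ValiantsHypothesis.ValiantsHypothesis.…` repeats a component by the D-0017 layout
-- (single-conjunct summit), which the `dupNamespace` linter flags; the name is mandated.
set_option linter.dupNamespace false

namespace Summit.ValiantsHypothesis.ValiantsHypothesis.Theorems.LacunarySymmetroidMatrixDescartes.Census

open Polynomial Finset
open scoped BigOperators Polynomial

/-! ### Four Euler twists: the residual quadratic form -/

/-- **Edge `0..9`, four twists.**  Killing the free letters `q₀, b₁X^{d₁}, b₂X^{d₂}, b₃X^{d₃}` of the edge form by the
Euler twists at the weights `0, d₁, d₂, d₃` costs at most four positive roots (with multiplicity) and leaves the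
6-nomial `G = Σ_{i≤j} (2−δ_{ij}) m(d_i+d_j) y_i y_j X^{d_i+d_j}`, `m(a) = a(a−d₁)(a−d₂)(a−d₃)` (up to sign). [folklore] -/
theorem countP_posRoots_edge09_le_residual (d₁ d₂ d₃ : ℕ) (q₀ b₁ b₂ b₃ y₁ y₂ y₃ : ℝ)
    (M₁₁ M₁₂ M₂₂ M₁₃ M₂₃ M₃₃ : ℝ)
    (hM₁₁ : M₁₁ = (2 * d₁ : ℝ) * ((2 * d₁ : ℝ) - d₁) * ((2 * d₁ : ℝ) - d₂) * ((2 * d₁ : ℝ) - d₃))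
    (hM₁₂ : M₁₂ = ((d₁ : ℝ) + d₂) * ((d₁ : ℝ) + d₂ - d₁) * ((d₁ : ℝ) + d₂ - d₂) * ((d₁ : ℝ) + d₂ - d₃))
    (hM₂₂ : M₂₂ = (2 * d₂ : ℝ) * ((2 * d₂ : ℝ) - d₁) * ((2 * d₂ : ℝ) - d₂) * ((2 * d₂ : ℝ) - d₃))
    (hM₁₃ : M₁₃ = ((d₁ : ℝ) + d₃) * ((d₁ : ℝ) + d₃ - d₁) * ((d₁ : ℝ) + d₃ - d₂) * ((d₁ : ℝ) + d₃ - d₃))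
    (hM₂₃ : M₂₃ = ((d₂ : ℝ) + d₃) * ((d₂ : ℝ) + d₃ - d₁) * ((d₂ : ℝ) + d₃ - d₂) * ((d₂ : ℝ) + d₃ - d₃))
    (hM₃₃ : M₃₃ = (2 * d₃ : ℝ) * ((2 * d₃ : ℝ) - d₁) * ((2 * d₃ : ℝ) - d₂) * ((2 * d₃ : ℝ) - d₃)) :
    ((C q₀ + C b₁ * X ^ d₁ + C b₂ * X ^ d₂ + C b₃ * X ^ d₃
        - (C y₁ * X ^ d₁ + C y₂ * X ^ d₂ + C y₃ * X ^ d₃) ^ 2 : ℝ[X]).roots.countP (fun x => 0 < x))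
      ≤ ((C (M₁₁ * y₁ ^ 2) * X ^ (2 * d₁) + C (2 * M₁₂ * y₁ * y₂) * X ^ (d₁ + d₂) + C (M₂₂ * y₂ ^ 2) * X ^ (2 * d₂)
          + C (2 * M₁₃ * y₁ * y₃) * X ^ (d₁ + d₃) + C (2 * M₂₃ * y₂ * y₃) * X ^ (d₂ + d₃)
          + C (M₃₃ * y₃ ^ 2) * X ^ (2 * d₃) : ℝ[X]).roots.countP (fun x => 0 < x)) + 4 := by
  classical
  -- the ten terms: the six quadratic ones first (kept), then the four free letters (killed)
  set e : ℕ → ℕ := fun t => match t with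
    | 0 => 2 * d₁ | 1 => d₁ + d₂ | 2 => 2 * d₂ | 3 => d₁ + d₃ | 4 => d₂ + d₃ | 5 => 2 * d₃
    | 6 => 0 | 7 => d₁ | 8 => d₂ | 9 => d₃ | _ => 0 with he
  set c : ℕ → ℝ := fun t => match t with
    | 0 => -(y₁ ^ 2) | 1 => -(y₁ * y₂ + y₁ * y₂) | 2 => -(y₂ ^ 2) | 3 => -(y₁ * y₃ + y₁ * y₃)
    | 4 => -(y₂ * y₃ + y₂ * y₃) | 5 => -(y₃ ^ 2) | 6 => q₀ | 7 => b₁ | 8 => b₂ | 9 => b₃ | _ => 0 with hc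
  have hF : (C q₀ + C b₁ * X ^ d₁ + C b₂ * X ^ d₂ + C b₃ * X ^ d₃
        - (C y₁ * X ^ d₁ + C y₂ * X ^ d₂ + C y₃ * X ^ d₃) ^ 2 : ℝ[X]) = ∑ t ∈ range 10, C (c t) * X ^ (e t) := by
    simp only [Finset.sum_range_succ, Finset.sum_range_zero, zero_add, he, hc, map_mul, map_neg,
      map_pow, map_add, pow_add, two_mul, pow_zero, mul_one]
    ring
  rw [hF]
  have step := countP_posRoots_le_countP_twists 10 e c (Ico 6 10)
  have hcard : (Ico 6 10).card = 4 := by simp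
  rw [hcard] at step
  obtain ⟨M, hM⟩ : ∃ M : ℕ → ℝ, ∀ t, M t = ∏ u ∈ Ico 6 10, ((e t : ℝ) - e u) := ⟨_, fun _ => rfl⟩
  have hres : (∑ t ∈ range 10, C (c t * ∏ u ∈ Ico 6 10, ((e t : ℝ) - e u)) * X ^ (e t) : ℝ[X])
      = C (c 0 * M 0) * X ^ (e 0) + C (c 1 * M 1) * X ^ (e 1) + C (c 2 * M 2) * X ^ (e 2)
        + C (c 3 * M 3) * X ^ (e 3) + C (c 4 * M 4) * X ^ (e 4) + C (c 5 * M 5) * X ^ (e 5) := by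
    rw [Finset.range_eq_Ico, ← Finset.sum_Ico_consecutive _ (show 0 ≤ 6 by norm_num) (show 6 ≤ 10 by norm_num)]
    have hz : (∑ t ∈ Ico 6 10, C (c t * ∏ u ∈ Ico 6 10, ((e t : ℝ) - e u)) * X ^ (e t) : ℝ[X]) = 0 := by
      refine Finset.sum_eq_zero fun t ht => ?_
      rw [Finset.prod_eq_zero ht (sub_self _), mul_zero, map_zero, zero_mul]
    rw [hz, add_zero, Nat.Ico_zero_eq_range]
    simp only [Finset.sum_range_succ, Finset.sum_range_zero, zero_add, ← hM]
  rw [hres] at step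
  have unroll : ∀ t, M t = ((e t : ℝ) - e 6) * ((e t : ℝ) - e 7) * ((e t : ℝ) - e 8) * ((e t : ℝ) - e 9) := by
    intro t
    rw [hM, Finset.prod_Ico_eq_prod_range]
    simp only [show (10 : ℕ) - 6 = 4 by norm_num, Finset.prod_range_succ, Finset.prod_range_zero, one_mul,
      Nat.reduceAdd]
  have e0 : e 0 = 2 * d₁ := rfl
  have e1 : e 1 = d₁ + d₂ := rfl
  have e2 : e 2 = 2 * d₂ := rfl
  have e3 : e 3 = d₁ + d₃ := rfl
  have e4 : e 4 = d₂ + d₃ := rfl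
  have e5 : e 5 = 2 * d₃ := rfl
  have e6 : e 6 = 0 := rfl
  have e7 : e 7 = d₁ := rfl
  have e8 : e 8 = d₂ := rfl
  have e9 : e 9 = d₃ := rfl
  have c0 : c 0 = -(y₁ ^ 2) := rfl
  have c1 : c 1 = -(y₁ * y₂ + y₁ * y₂) := rfl
  have c2 : c 2 = -(y₂ ^ 2) := rfl
  have c3 : c 3 = -(y₁ * y₃ + y₁ * y₃) := rfl
  have c4 : c 4 = -(y₂ * y₃ + y₂ * y₃) := rfl
  have c5 : c 5 = -(y₃ ^ 2) := rfl
  have hM0 : M 0 = M₁₁ := by rw [unroll, e0, e6, e7, e8, e9, hM₁₁]; push_cast; ring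
  have hM1 : M 1 = M₁₂ := by rw [unroll, e1, e6, e7, e8, e9, hM₁₂]; push_cast; ring
  have hM2 : M 2 = M₂₂ := by rw [unroll, e2, e6, e7, e8, e9, hM₂₂]; push_cast; ring
  have hM3 : M 3 = M₁₃ := by rw [unroll, e3, e6, e7, e8, e9, hM₁₃]; push_cast; ring
  have hM4 : M 4 = M₂₃ := by rw [unroll, e4, e6, e7, e8, e9, hM₂₃]; push_cast; ring
  have hM5 : M 5 = M₃₃ := by rw [unroll, e5, e6, e7, e8, e9, hM₃₃]; push_cast; ring
  rw [e0, e1, e2, e3, e4, e5, c0, c1, c2, c3, c4, c5, hM0, hM1, hM2, hM3, hM4, hM5] at step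
  -- the residual is `−G`
  have hneg : (C (-(y₁ ^ 2) * M₁₁) * X ^ (2 * d₁) + C (-(y₁ * y₂ + y₁ * y₂) * M₁₂) * X ^ (d₁ + d₂)
        + C (-(y₂ ^ 2) * M₂₂) * X ^ (2 * d₂) + C (-(y₁ * y₃ + y₁ * y₃) * M₁₃) * X ^ (d₁ + d₃)
        + C (-(y₂ * y₃ + y₂ * y₃) * M₂₃) * X ^ (d₂ + d₃) + C (-(y₃ ^ 2) * M₃₃) * X ^ (2 * d₃) : ℝ[X])
      = -(C (M₁₁ * y₁ ^ 2) * X ^ (2 * d₁) + C (2 * M₁₂ * y₁ * y₂) * X ^ (d₁ + d₂) + C (M₂₂ * y₂ ^ 2) * X ^ (2 * d₂)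
          + C (2 * M₁₃ * y₁ * y₃) * X ^ (d₁ + d₃) + C (2 * M₂₃ * y₂ * y₃) * X ^ (d₂ + d₃)
          + C (M₃₃ * y₃ ^ 2) * X ^ (2 * d₃)) := by
    simp only [map_mul, map_neg, map_add, map_pow, map_ofNat]
    ring
  rw [hneg, countP_posRoots_neg] at step
  exact step

/-! ### The Wronskian-type twist of a split quadratic form -/

/-- The 7-nomial `X·W`, `W = p·R′ − 2R·p′`, for `p = v₁X^{d₁} + v₂X^{d₂} + v₃X^{d₃}` and the 6-nomial
`R = r₁₁X^{2d₁} + r₁₂X^{d₁+d₂} + r₂₂X^{2d₂} + r₁₃X^{d₁+d₃} + r₂₃X^{d₂+d₃} + r₃₃X^{2d₃}` (the terms at `X^{3d_i}` cancel).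
[folklore] -/
theorem X_mul_sqTwist_quadform (d₁ d₂ d₃ : ℕ) (r₁₁ r₁₂ r₂₂ r₁₃ r₂₃ r₃₃ v₁ v₂ v₃ : ℝ) :
    X * ((C v₁ * X ^ d₁ + C v₂ * X ^ d₂ + C v₃ * X ^ d₃)
          * derivative (C r₁₁ * X ^ (2 * d₁) + C r₁₂ * X ^ (d₁ + d₂) + C r₂₂ * X ^ (2 * d₂)
              + C r₁₃ * X ^ (d₁ + d₃) + C r₂₃ * X ^ (d₂ + d₃) + C r₃₃ * X ^ (2 * d₃))
        - 2 * (C r₁₁ * X ^ (2 * d₁) + C r₁₂ * X ^ (d₁ + d₂) + C r₂₂ * X ^ (2 * d₂)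
              + C r₁₃ * X ^ (d₁ + d₃) + C r₂₃ * X ^ (d₂ + d₃) + C r₃₃ * X ^ (2 * d₃))
          * derivative (C v₁ * X ^ d₁ + C v₂ * X ^ d₂ + C v₃ * X ^ d₃))
      = C (((d₂ : ℝ) - d₁) * (v₁ * r₁₂ - 2 * v₂ * r₁₁)) * X ^ (2 * d₁ + d₂)
        + C (((d₂ : ℝ) - d₁) * (2 * v₁ * r₂₂ - v₂ * r₁₂)) * X ^ (d₁ + 2 * d₂)
        + C (((d₃ : ℝ) - d₁) * (v₁ * r₁₃ - 2 * v₃ * r₁₁)) * X ^ (2 * d₁ + d₃)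
        + C (v₁ * r₂₃ * ((d₂ : ℝ) + d₃ - 2 * d₁) + v₂ * r₁₃ * ((d₁ : ℝ) + d₃ - 2 * d₂)
            + v₃ * r₁₂ * ((d₁ : ℝ) + d₂ - 2 * d₃)) * X ^ (d₁ + d₂ + d₃)
        + C (((d₃ : ℝ) - d₂) * (v₂ * r₂₃ - 2 * v₃ * r₂₂)) * X ^ (2 * d₂ + d₃)
        + C (((d₃ : ℝ) - d₁) * (2 * v₁ * r₃₃ - v₃ * r₁₃)) * X ^ (d₁ + 2 * d₃)
        + C (((d₃ : ℝ) - d₂) * (2 * v₂ * r₃₃ - v₃ * r₂₃)) * X ^ (d₂ + 2 * d₃) := by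
  have e1 := Literature.Analysis.FluidPDE.Elgindi.X_mul_derivative_X_pow d₁
  have e2 := Literature.Analysis.FluidPDE.Elgindi.X_mul_derivative_X_pow d₂
  have e3 := Literature.Analysis.FluidPDE.Elgindi.X_mul_derivative_X_pow d₃
  have e11 := Literature.Analysis.FluidPDE.Elgindi.X_mul_derivative_X_pow (2 * d₁)
  have e12 := Literature.Analysis.FluidPDE.Elgindi.X_mul_derivative_X_pow (d₁ + d₂)
  have e22 := Literature.Analysis.FluidPDE.Elgindi.X_mul_derivative_X_pow (2 * d₂)
  have e13 := Literature.Analysis.FluidPDE.Elgindi.X_mul_derivative_X_pow (d₁ + d₃)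
  have e23 := Literature.Analysis.FluidPDE.Elgindi.X_mul_derivative_X_pow (d₂ + d₃)
  have e33 := Literature.Analysis.FluidPDE.Elgindi.X_mul_derivative_X_pow (2 * d₃)
  have hR : X * derivative (C r₁₁ * X ^ (2 * d₁) + C r₁₂ * X ^ (d₁ + d₂) + C r₂₂ * X ^ (2 * d₂)
        + C r₁₃ * X ^ (d₁ + d₃) + C r₂₃ * X ^ (d₂ + d₃) + C r₃₃ * X ^ (2 * d₃) : ℝ[X])
      = C r₁₁ * (C ((2 * d₁ : ℕ) : ℝ) * X ^ (2 * d₁)) + C r₁₂ * (C ((d₁ + d₂ : ℕ) : ℝ) * X ^ (d₁ + d₂))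
        + C r₂₂ * (C ((2 * d₂ : ℕ) : ℝ) * X ^ (2 * d₂)) + C r₁₃ * (C ((d₁ + d₃ : ℕ) : ℝ) * X ^ (d₁ + d₃))
        + C r₂₃ * (C ((d₂ + d₃ : ℕ) : ℝ) * X ^ (d₂ + d₃)) + C r₃₃ * (C ((2 * d₃ : ℕ) : ℝ) * X ^ (2 * d₃)) := by
    rw [← e11, ← e12, ← e22, ← e13, ← e23, ← e33]; simp only [derivative_add, derivative_C_mul]; ring
  have hp : X * derivative (C v₁ * X ^ d₁ + C v₂ * X ^ d₂ + C v₃ * X ^ d₃ : ℝ[X])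
      = C v₁ * (C (d₁ : ℝ) * X ^ d₁) + C v₂ * (C (d₂ : ℝ) * X ^ d₂) + C v₃ * (C (d₃ : ℝ) * X ^ d₃) := by
    rw [← e1, ← e2, ← e3]; simp only [derivative_add, derivative_C_mul]; ring
  calc X * ((C v₁ * X ^ d₁ + C v₂ * X ^ d₂ + C v₃ * X ^ d₃)
          * derivative (C r₁₁ * X ^ (2 * d₁) + C r₁₂ * X ^ (d₁ + d₂) + C r₂₂ * X ^ (2 * d₂)
              + C r₁₃ * X ^ (d₁ + d₃) + C r₂₃ * X ^ (d₂ + d₃) + C r₃₃ * X ^ (2 * d₃))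
        - 2 * (C r₁₁ * X ^ (2 * d₁) + C r₁₂ * X ^ (d₁ + d₂) + C r₂₂ * X ^ (2 * d₂)
              + C r₁₃ * X ^ (d₁ + d₃) + C r₂₃ * X ^ (d₂ + d₃) + C r₃₃ * X ^ (2 * d₃))
          * derivative (C v₁ * X ^ d₁ + C v₂ * X ^ d₂ + C v₃ * X ^ d₃))
      = (C v₁ * X ^ d₁ + C v₂ * X ^ d₂ + C v₃ * X ^ d₃)
          * (X * derivative (C r₁₁ * X ^ (2 * d₁) + C r₁₂ * X ^ (d₁ + d₂) + C r₂₂ * X ^ (2 * d₂)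
              + C r₁₃ * X ^ (d₁ + d₃) + C r₂₃ * X ^ (d₂ + d₃) + C r₃₃ * X ^ (2 * d₃)))
        - 2 * (C r₁₁ * X ^ (2 * d₁) + C r₁₂ * X ^ (d₁ + d₂) + C r₂₂ * X ^ (2 * d₂)
              + C r₁₃ * X ^ (d₁ + d₃) + C r₂₃ * X ^ (d₂ + d₃) + C r₃₃ * X ^ (2 * d₃))
          * (X * derivative (C v₁ * X ^ d₁ + C v₂ * X ^ d₂ + C v₃ * X ^ d₃)) := by
        ring
    _ = _ := by
        rw [hR, hp]
        push_cast
        simp only [map_add, map_mul, map_sub, pow_add, two_mul]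
        ring

/-! ### Two sign blocks on seven exponents -/

/-- **Two sign blocks ⇒ at most one sign variation** (seven exponents `e₁ < ⋯ < e₇`, weights `w₁, …, w₆ ≥ 0 ≥ w₇`).
[folklore] -/
theorem signVariations_le_one_of_blocks7 (Q : ℝ[X]) (e₁ e₂ e₃ e₄ e₅ e₆ e₇ : ℕ) (w₁ w₂ w₃ w₄ w₅ w₆ w₇ : ℝ)
    (h12 : e₁ < e₂) (h23 : e₂ < e₃) (h34 : e₃ < e₄) (h45 : e₄ < e₅) (h56 : e₅ < e₆) (h67 : e₆ < e₇)
    (hcoeff : ∀ m, Q.coeff m = (if m = e₁ then w₁ else 0) + (if m = e₂ then w₂ else 0) + (if m = e₃ then w₃ else 0)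
      + (if m = e₄ then w₄ else 0) + (if m = e₅ then w₅ else 0) + (if m = e₆ then w₆ else 0)
      + (if m = e₇ then w₇ else 0))
    (hw₁ : 0 ≤ w₁) (hw₂ : 0 ≤ w₂) (hw₃ : 0 ≤ w₃) (hw₄ : 0 ≤ w₄) (hw₅ : 0 ≤ w₅) (hw₆ : 0 ≤ w₆) (hw₇ : w₇ ≤ 0)
    (hdeg : Q.natDegree < e₇ + 1) : Q.signVariations ≤ 1 := by
  have key := signVariations_succ_le_of_blocks 2 Q (fun k => if k < 1 then 0 else if k < 2 then e₇ else e₇ + 1)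
    (if_pos (by norm_num)) ?_ ?_ ?_
  · omega
  · refine monotone_nat_of_le_succ fun k => ?_
    rcases Nat.lt_or_ge k 2 with hk | hk
    · interval_cases k
      · simp
      · simp
    · simp only [if_neg (show ¬ k < 1 by omega), if_neg (show ¬ k < 2 by omega), if_neg (show ¬ k + 1 < 1 by omega),
        if_neg (show ¬ k + 1 < 2 by omega)]
      exact le_rfl
  · simp only [show ¬ (2 : ℕ) < 1 by norm_num, lt_irrefl, if_false]
    exact hdeg
  · have hite : ∀ (q : Prop) [Decidable q] (w : ℝ), 0 ≤ w → 0 ≤ (if q then w else 0) := by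
      intro q _ w hw
      split_ifs
      · exact hw
      · exact le_rfl
    intro i hi
    interval_cases i
    · refine ⟨1, Or.inl rfl, fun m _ hm2 => ?_⟩
      simp only [show (0 : ℕ) + 1 < 2 by norm_num, show ¬ (0 : ℕ) + 1 < 1 by norm_num, if_true, if_false] at hm2
      rw [hcoeff m, if_neg (show m ≠ e₇ by omega), one_mul, add_zero]
      exact add_nonneg (add_nonneg (add_nonneg (add_nonneg (add_nonneg (hite _ _ hw₁) (hite _ _ hw₂))
        (hite _ _ hw₃)) (hite _ _ hw₄)) (hite _ _ hw₅)) (hite _ _ hw₆)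
    · refine ⟨-1, Or.inr rfl, fun m hm1 hm2 => ?_⟩
      simp only [show (1 : ℕ) < 2 by norm_num, show ¬ (1 : ℕ) < 1 by norm_num, if_true, if_false] at hm1
      simp only [show ¬ (1 : ℕ) + 1 < 2 by norm_num, show ¬ (1 : ℕ) + 1 < 1 by norm_num, if_false] at hm2
      have hm : m = e₇ := by omega
      rw [hcoeff m, if_neg (show m ≠ e₁ by omega), if_neg (show m ≠ e₂ by omega), if_neg (show m ≠ e₃ by omega),
        if_neg (show m ≠ e₄ by omega), if_neg (show m ≠ e₅ by omega), if_neg (show m ≠ e₆ by omega), if_pos hm]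
      simp only [add_zero, zero_add]
      linarith

/-! ### The split: `G = Yᵀ(P − uuᵀ)Y = R − p²` with `P ⪰ 0` by `LDLᵀ` data -/

/-- **SPLIT LEMMA (quadratic form on the moment curve minus a rank-one square).**  Let `d₁ < d₂ < d₃` with
`2d₂ < d₁ + d₃`, `y₁ > 0 > y₂`, `y₃ > 0`, and let `A = P − uuᵀ` where `P` is positive semidefinite with the rational
`LDLᵀ` certificate `P = a·(1,b₁,b₂)(1,b₁,b₂)ᵀ + c·(0,1,e)(0,1,e)ᵀ + f·(0,0,1)(0,0,1)ᵀ`, `a, c ≥ 0`, `f > 0`.  Then the 6-nomial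
`G = Σ_{i≤j} (2−δ_{ij}) A_{ij} y_i y_j X^{d_i+d_j}` equals `R − p²`, `R = Σ (2−δ)P_{ij}y_iy_jX^{d_i+d_j} > 0` on `(0,∞)`,
`p = Σ u_iy_iX^{d_i}`, and if the seven coefficients of `X·(pR′ − 2Rp′)` have the sign blocks `(≥0)⁶ | (<0)` — the seven
hypotheses `hk₁ … hk₇`, stated after dividing by the fixed-sign `y`-monomials — then by the tree's RUNS LEMMA
`#Z₊^{mult}(G) ≤ #Z₊^{mult}(p) + 2`. [folklore] -/
theorem countP_posRoots_quadform_le (d₁ d₂ d₃ : ℕ) (h₁ : d₁ < d₂) (h₂ : d₂ < d₃) (h₃ : 2 * d₂ < d₁ + d₃)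
    (y₁ y₂ y₃ : ℝ) (hy₁ : 0 < y₁) (hy₂ : y₂ < 0) (hy₃ : 0 < y₃)
    (A₁₁ A₁₂ A₂₂ A₁₃ A₂₃ A₃₃ u₁ u₂ u₃ a b₁ b₂ c e f : ℝ) (ha : 0 ≤ a) (hc : 0 ≤ c) (hf : 0 < f)
    (hP₁₁ : A₁₁ + u₁ ^ 2 = a) (hP₁₂ : A₁₂ + u₁ * u₂ = a * b₁) (hP₁₃ : A₁₃ + u₁ * u₃ = a * b₂)
    (hP₂₂ : A₂₂ + u₂ ^ 2 = a * b₁ ^ 2 + c) (hP₂₃ : A₂₃ + u₂ * u₃ = a * b₁ * b₂ + c * e)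
    (hP₃₃ : A₃₃ + u₃ ^ 2 = a * b₂ ^ 2 + c * e ^ 2 + f)
    (hk₁ : u₁ * (A₁₂ + u₁ * u₂) - u₂ * (A₁₁ + u₁ ^ 2) ≤ 0)
    (hk₂ : 0 ≤ u₁ * (A₂₂ + u₂ ^ 2) - u₂ * (A₁₂ + u₁ * u₂))
    (hk₃ : 0 ≤ u₁ * (A₁₃ + u₁ * u₃) - u₃ * (A₁₁ + u₁ ^ 2))
    (hk₄ : u₁ * (A₂₃ + u₂ * u₃) * ((d₂ : ℝ) + d₃ - 2 * d₁) + u₂ * (A₁₃ + u₁ * u₃) * ((d₁ : ℝ) + d₃ - 2 * d₂)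
        + u₃ * (A₁₂ + u₁ * u₂) * ((d₁ : ℝ) + d₂ - 2 * d₃) ≤ 0)
    (hk₅ : 0 ≤ u₂ * (A₂₃ + u₂ * u₃) - u₃ * (A₂₂ + u₂ ^ 2))
    (hk₆ : 0 ≤ u₁ * (A₃₃ + u₃ ^ 2) - u₃ * (A₁₃ + u₁ * u₃))
    (hk₇ : 0 < u₂ * (A₃₃ + u₃ ^ 2) - u₃ * (A₂₃ + u₂ * u₃)) :
    ((C (A₁₁ * y₁ ^ 2) * X ^ (2 * d₁) + C (2 * A₁₂ * y₁ * y₂) * X ^ (d₁ + d₂) + C (A₂₂ * y₂ ^ 2) * X ^ (2 * d₂)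
        + C (2 * A₁₃ * y₁ * y₃) * X ^ (d₁ + d₃) + C (2 * A₂₃ * y₂ * y₃) * X ^ (d₂ + d₃)
        + C (A₃₃ * y₃ ^ 2) * X ^ (2 * d₃) : ℝ[X]).roots.countP (fun x => 0 < x))
      ≤ ((C (u₁ * y₁) * X ^ d₁ + C (u₂ * y₂) * X ^ d₂ + C (u₃ * y₃) * X ^ d₃ : ℝ[X]).roots.countP
          (fun x => 0 < x)) + 2 := by
  classical
  -- names
  obtain ⟨p, hpdef⟩ : ∃ q : ℝ[X], q = C (u₁ * y₁) * X ^ d₁ + C (u₂ * y₂) * X ^ d₂ + C (u₃ * y₃) * X ^ d₃ := ⟨_, rfl⟩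
  obtain ⟨R, hRdef⟩ : ∃ q : ℝ[X], q = C ((A₁₁ + u₁ ^ 2) * y₁ ^ 2) * X ^ (2 * d₁)
      + C (2 * (A₁₂ + u₁ * u₂) * y₁ * y₂) * X ^ (d₁ + d₂) + C ((A₂₂ + u₂ ^ 2) * y₂ ^ 2) * X ^ (2 * d₂)
      + C (2 * (A₁₃ + u₁ * u₃) * y₁ * y₃) * X ^ (d₁ + d₃) + C (2 * (A₂₃ + u₂ * u₃) * y₂ * y₃) * X ^ (d₂ + d₃)
      + C ((A₃₃ + u₃ ^ 2) * y₃ ^ 2) * X ^ (2 * d₃) := ⟨_, rfl⟩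
  -- `G = R − p²`
  have hG : (C (A₁₁ * y₁ ^ 2) * X ^ (2 * d₁) + C (2 * A₁₂ * y₁ * y₂) * X ^ (d₁ + d₂) + C (A₂₂ * y₂ ^ 2) * X ^ (2 * d₂)
        + C (2 * A₁₃ * y₁ * y₃) * X ^ (d₁ + d₃) + C (2 * A₂₃ * y₂ * y₃) * X ^ (d₂ + d₃)
        + C (A₃₃ * y₃ ^ 2) * X ^ (2 * d₃) : ℝ[X]) = R - p ^ 2 := by
    rw [hRdef, hpdef]
    simp only [map_mul, map_add, map_pow, pow_add, two_mul]
    ring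
  rw [hG, ← hpdef]
  -- `R > 0` on `(0,∞)` by the `LDLᵀ` certificate
  have hRpos : ∀ x : ℝ, 0 < x → 0 < R.eval x := by
    intro x hx
    have hY₃ : 0 < y₃ * x ^ d₃ := mul_pos hy₃ (pow_pos hx _)
    have hev : R.eval x = a * (y₁ * x ^ d₁ + b₁ * (y₂ * x ^ d₂) + b₂ * (y₃ * x ^ d₃)) ^ 2
        + c * (y₂ * x ^ d₂ + e * (y₃ * x ^ d₃)) ^ 2 + f * (y₃ * x ^ d₃) ^ 2 := by
      rw [hRdef]
      simp only [eval_add, eval_mul, eval_C, eval_pow, eval_X, hP₁₁, hP₁₂, hP₁₃, hP₂₂, hP₂₃, hP₃₃]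
      ring
    rw [hev]
    have t1 : 0 ≤ a * (y₁ * x ^ d₁ + b₁ * (y₂ * x ^ d₂) + b₂ * (y₃ * x ^ d₃)) ^ 2 := mul_nonneg ha (sq_nonneg _)
    have t2 : 0 ≤ c * (y₂ * x ^ d₂ + e * (y₃ * x ^ d₃)) ^ 2 := mul_nonneg hc (sq_nonneg _)
    have t3 : 0 < f * (y₃ * x ^ d₃) ^ 2 := mul_pos hf (pow_pos hY₃ 2)
    linarith
  -- the twist `W` and the 7-nomial `X·W`
  obtain ⟨W, hWdef⟩ : ∃ q : ℝ[X], q = p * derivative R - 2 * R * derivative p := ⟨_, rfl⟩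
  have hXW := X_mul_sqTwist_quadform d₁ d₂ d₃ ((A₁₁ + u₁ ^ 2) * y₁ ^ 2) (2 * (A₁₂ + u₁ * u₂) * y₁ * y₂)
    ((A₂₂ + u₂ ^ 2) * y₂ ^ 2) (2 * (A₁₃ + u₁ * u₃) * y₁ * y₃) (2 * (A₂₃ + u₂ * u₃) * y₂ * y₃)
    ((A₃₃ + u₃ ^ 2) * y₃ ^ 2) (u₁ * y₁) (u₂ * y₂) (u₃ * y₃)
  rw [← hpdef, ← hRdef, ← hWdef] at hXW
  -- the seven weights and their signs
  set w₁ : ℝ := ((d₂ : ℝ) - d₁) * (u₁ * y₁ * (2 * (A₁₂ + u₁ * u₂) * y₁ * y₂)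
    - 2 * (u₂ * y₂) * ((A₁₁ + u₁ ^ 2) * y₁ ^ 2)) with hw₁
  set w₂ : ℝ := ((d₂ : ℝ) - d₁) * (2 * (u₁ * y₁) * ((A₂₂ + u₂ ^ 2) * y₂ ^ 2)
    - u₂ * y₂ * (2 * (A₁₂ + u₁ * u₂) * y₁ * y₂)) with hw₂
  set w₃ : ℝ := ((d₃ : ℝ) - d₁) * (u₁ * y₁ * (2 * (A₁₃ + u₁ * u₃) * y₁ * y₃)
    - 2 * (u₃ * y₃) * ((A₁₁ + u₁ ^ 2) * y₁ ^ 2)) with hw₃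
  set w₄ : ℝ := u₁ * y₁ * (2 * (A₂₃ + u₂ * u₃) * y₂ * y₃) * ((d₂ : ℝ) + d₃ - 2 * d₁)
    + u₂ * y₂ * (2 * (A₁₃ + u₁ * u₃) * y₁ * y₃) * ((d₁ : ℝ) + d₃ - 2 * d₂)
    + u₃ * y₃ * (2 * (A₁₂ + u₁ * u₂) * y₁ * y₂) * ((d₁ : ℝ) + d₂ - 2 * d₃) with hw₄
  set w₅ : ℝ := ((d₃ : ℝ) - d₂) * (u₂ * y₂ * (2 * (A₂₃ + u₂ * u₃) * y₂ * y₃)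
    - 2 * (u₃ * y₃) * ((A₂₂ + u₂ ^ 2) * y₂ ^ 2)) with hw₅
  set w₆ : ℝ := ((d₃ : ℝ) - d₁) * (2 * (u₁ * y₁) * ((A₃₃ + u₃ ^ 2) * y₃ ^ 2)
    - u₃ * y₃ * (2 * (A₁₃ + u₁ * u₃) * y₁ * y₃)) with hw₆
  set w₇ : ℝ := ((d₃ : ℝ) - d₂) * (2 * (u₂ * y₂) * ((A₃₃ + u₃ ^ 2) * y₃ ^ 2)
    - u₃ * y₃ * (2 * (A₂₃ + u₂ * u₃) * y₂ * y₃)) with hw₇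
  have r21 : (0 : ℝ) < (d₂ : ℝ) - d₁ := by
    have : (d₁ : ℝ) < d₂ := by exact_mod_cast h₁
    linarith
  have r31 : (0 : ℝ) < (d₃ : ℝ) - d₁ := by
    have : (d₁ : ℝ) < d₃ := by exact_mod_cast (h₁.trans h₂)
    linarith
  have r32 : (0 : ℝ) < (d₃ : ℝ) - d₂ := by
    have : (d₂ : ℝ) < d₃ := by exact_mod_cast h₂
    linarith
  have hy₂' : 0 < -y₂ := neg_pos.mpr hy₂
  have hw₁p : 0 ≤ w₁ := by
    have iden : w₁ = 2 * ((d₂ : ℝ) - d₁) * (y₁ ^ 2 * (-y₂))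
        * (-(u₁ * (A₁₂ + u₁ * u₂) - u₂ * (A₁₁ + u₁ ^ 2))) := by rw [hw₁]; ring
    rw [iden]
    have : 0 ≤ y₁ ^ 2 * (-y₂) := by positivity
    have : 0 ≤ 2 * ((d₂ : ℝ) - d₁) * (y₁ ^ 2 * (-y₂)) := by positivity
    exact mul_nonneg this (by linarith)
  have hw₂p : 0 ≤ w₂ := by
    have iden : w₂ = 2 * ((d₂ : ℝ) - d₁) * (y₁ * y₂ ^ 2)
        * (u₁ * (A₂₂ + u₂ ^ 2) - u₂ * (A₁₂ + u₁ * u₂)) := by rw [hw₂]; ring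
    rw [iden]
    have : 0 ≤ 2 * ((d₂ : ℝ) - d₁) * (y₁ * y₂ ^ 2) := by positivity
    exact mul_nonneg this hk₂
  have hw₃p : 0 ≤ w₃ := by
    have iden : w₃ = 2 * ((d₃ : ℝ) - d₁) * (y₁ ^ 2 * y₃)
        * (u₁ * (A₁₃ + u₁ * u₃) - u₃ * (A₁₁ + u₁ ^ 2)) := by rw [hw₃]; ring
    rw [iden]
    have : 0 ≤ 2 * ((d₃ : ℝ) - d₁) * (y₁ ^ 2 * y₃) := by positivity
    exact mul_nonneg this hk₃
  have hw₄p : 0 ≤ w₄ := by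
    have iden : w₄ = 2 * (y₁ * (-y₂) * y₃)
        * (-(u₁ * (A₂₃ + u₂ * u₃) * ((d₂ : ℝ) + d₃ - 2 * d₁) + u₂ * (A₁₃ + u₁ * u₃) * ((d₁ : ℝ) + d₃ - 2 * d₂)
            + u₃ * (A₁₂ + u₁ * u₂) * ((d₁ : ℝ) + d₂ - 2 * d₃))) := by rw [hw₄]; ring
    rw [iden]
    have : 0 ≤ 2 * (y₁ * (-y₂) * y₃) := by positivity
    exact mul_nonneg this (by linarith)
  have hw₅p : 0 ≤ w₅ := by
    have iden : w₅ = 2 * ((d₃ : ℝ) - d₂) * (y₂ ^ 2 * y₃)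
        * (u₂ * (A₂₃ + u₂ * u₃) - u₃ * (A₂₂ + u₂ ^ 2)) := by rw [hw₅]; ring
    rw [iden]
    have : 0 ≤ 2 * ((d₃ : ℝ) - d₂) * (y₂ ^ 2 * y₃) := by positivity
    exact mul_nonneg this hk₅
  have hw₆p : 0 ≤ w₆ := by
    have iden : w₆ = 2 * ((d₃ : ℝ) - d₁) * (y₁ * y₃ ^ 2)
        * (u₁ * (A₃₃ + u₃ ^ 2) - u₃ * (A₁₃ + u₁ * u₃)) := by rw [hw₆]; ring
    rw [iden]
    have : 0 ≤ 2 * ((d₃ : ℝ) - d₁) * (y₁ * y₃ ^ 2) := by positivity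
    exact mul_nonneg this hk₆
  have hw₇n : w₇ < 0 := by
    have iden : w₇ = -(2 * ((d₃ : ℝ) - d₂) * ((-y₂) * y₃ ^ 2)
        * (u₂ * (A₃₃ + u₃ ^ 2) - u₃ * (A₂₃ + u₂ * u₃))) := by rw [hw₇]; ring
    rw [iden, neg_lt_zero]
    have : 0 < 2 * ((d₃ : ℝ) - d₂) * ((-y₂) * y₃ ^ 2) := by positivity
    exact mul_pos this hk₇
  -- coefficients of `X·W`
  have hcoeff : ∀ m, (X * W).coeff m = (if m = 2 * d₁ + d₂ then w₁ else 0) + (if m = d₁ + 2 * d₂ then w₂ else 0)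
      + (if m = 2 * d₁ + d₃ then w₃ else 0) + (if m = d₁ + d₂ + d₃ then w₄ else 0)
      + (if m = 2 * d₂ + d₃ then w₅ else 0) + (if m = d₁ + 2 * d₃ then w₆ else 0)
      + (if m = d₂ + 2 * d₃ then w₇ else 0) := by
    intro m
    rw [hXW]
    simp only [coeff_add, coeff_C_mul, coeff_X_pow, mul_ite, mul_one, mul_zero]
  -- `W ≠ 0` (top coefficient of `X·W`)
  have hXW0 : X * W ≠ 0 := by
    intro h0
    have := hcoeff (d₂ + 2 * d₃)
    rw [h0, coeff_zero, if_neg (by omega), if_neg (by omega), if_neg (by omega), if_neg (by omega),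
      if_neg (by omega), if_neg (by omega), if_pos rfl] at this
    linarith
  have hW0 : W ≠ 0 := fun h => hXW0 (by rw [h, mul_zero])
  -- `Var(X·W) ≤ 1` by two sign blocks
  have hdeg : (X * W).natDegree < d₂ + 2 * d₃ + 1 := by
    rw [Nat.lt_succ_iff, hXW]
    refine (natDegree_add_le _ _).trans (max_le ((natDegree_add_le _ _).trans (max_le
      ((natDegree_add_le _ _).trans (max_le ((natDegree_add_le _ _).trans (max_le
      ((natDegree_add_le _ _).trans (max_le ((natDegree_add_le _ _).trans (max_le ?_ ?_)) ?_)) ?_)) ?_)) ?_)) ?_)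
    all_goals exact (natDegree_C_mul_X_pow_le _ _).trans (by omega)
  have hvar : (X * W).signVariations ≤ 1 :=
    signVariations_le_one_of_blocks7 (X * W) (2 * d₁ + d₂) (d₁ + 2 * d₂) (2 * d₁ + d₃) (d₁ + d₂ + d₃)
      (2 * d₂ + d₃) (d₁ + 2 * d₃) (d₂ + 2 * d₃) w₁ w₂ w₃ w₄ w₅ w₆ w₇
      (by omega) (by omega) (by omega) (by omega) (by omega) (by omega)
      hcoeff hw₁p hw₂p hw₃p hw₄p hw₅p hw₆p hw₇n.le hdeg
  have hZW : W.roots.countP (fun x => 0 < x) ≤ 1 := by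
    have h1 : W.roots.countP (fun x => 0 < x) = (X * W).roots.countP (fun x => 0 < x) := by
      rw [← countP_posRoots_X_pow_mul W 1, pow_one]
    rw [h1]
    have := roots_countP_pos_le_signVariations (X * W)
    omega
  have runs := countP_posRoots_sub_sq_le_aux R p (R - p ^ 2) W rfl hWdef hRpos hW0
  omega

end Summit.ValiantsHypothesis.ValiantsHypothesis.Theorems.LacunarySymmetroidMatrixDescartes.Census
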